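import Literature.AnabelianGeometry.EtaleTheta.EtaleThetaClass

/-!
# Injectivity lemmas for the continuous `H¹` of [EtTh] §1 (restriction, inflation) and the
# non-vanishing of `log(Θ̈)`

Support lemmas (all PROVED, no named facts) for the continuous first cohomology `ContH1` of
`ContH1.lean` used throughout Mochizuki, *The étale theta function …* [EtTh], Publ. RIMS **45** (2009),
§1 (PRIMS PDF pp. 19–23) [cite: MochizukiEtTh2009, Prop 1.5 p.23]:

* `ContH1.mk_eq_one_iff` — a class vanishes iff the cocycle is a coboundary;
* `ContH1.res_injective_of_ge` — restriction between subgroups that coincide is injective;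
* `ContH1.infl_injective_of_surjective` — inflation along a homomorphism that is surjective onto the
  target subgroup is injective on `H¹` (the degree-one inflation–restriction statement used for
  "`η^Θ_N … arises from a cohomology class ∈ H¹(Π^tp_Y/Π^tp_{Z̈_N}, …)`", p. 20, and for the uniqueness
  half of Prop. 1.5 (iii), p. 23: `H¹((Π^tp_Ÿ)^Θ, Δ_Θ) → H¹(Π^tp_Ÿ, Δ_Θ)` is injective);
* `ThetaSetting.deltaTheta_eq_bot_of_logTheta_eq_one` / `logTheta_ne_one` — the class
  `log(Θ̈) = id ∈ Hom(Δ_Θ, Δ_Θ) = H¹(Δ_Θ, Δ_Θ)` (p. 23) is trivial only if `Δ_Θ = 1`; in particular it is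
  nontrivial under the origin guard `IsEtThOrigin` (non-vacuity of the `log(Θ̈)`-clause of Prop. 1.5 (iii)).

Seat abc-iut-L6-t23 (RQ7 audit; these are the generic lemmas behind the kernel witnesses of the
2026-08-25 audit of `EtaleThetaClass.lean`, requested as a tree file by abc-iut-L2-t12).
-/

noncomputable section

namespace Literature.AnabelianGeometry.EtaleTheta

open Literature.AnabelianGeometry.SemiGraphs
open scoped IsMulCommutative

/-! ### Generic facts about `ContH1` -/

namespace ContH1

variable {G G' : Type*} [Group G] [TopologicalSpace G]
  [Group G'] [TopologicalSpace G'] [IsTopologicalGroup G']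
  {φ : G →* G'} {A : Subgroup G'} [A.Normal] [IsMulCommutative A]

/-- A class of `H¹` vanishes iff the representing cocycle is a coboundary.
[cite: NeukirchSchmidtWingberg2008, I §2] -/
theorem mk_eq_one_iff {H : Subgroup G} (f : H → A) (hf : f ∈ contCocycles φ A H) :
    ContH1.mk f hf = 1 ↔ f ∈ contCoboundaries φ A H := by
  change (QuotientGroup.mk (⟨f, hf⟩ : contCocycles φ A H) :
      contCocycles φ A H ⧸ (contCoboundaries φ A H).subgroupOf (contCocycles φ A H)) = 1 ↔ _
  rw [QuotientGroup.eq_one_iff, Subgroup.mem_subgroupOf]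

/-- Restriction `H¹(H₂, A) → H¹(H₁, A)` along subgroups `H₁ ≤ H₂ ≤ H₁` (equal as sets) is injective.
[cite: NeukirchSchmidtWingberg2008, I §5] -/
theorem res_injective_of_ge {H₁ H₂ : Subgroup G} (h : H₁ ≤ H₂) (h' : H₂ ≤ H₁) :
    Function.Injective (ContH1.res φ A h) := by
  rw [injective_iff_map_eq_one]
  intro x hx
  induction x using QuotientGroup.induction_on with
  | H f =>
    have hfx : (QuotientGroup.mk (ContH1.resCocycle φ A h f) :
        contCocycles φ A H₁ ⧸ (contCoboundaries φ A H₁).subgroupOf (contCocycles φ A H₁)) = 1 := hx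
    rw [QuotientGroup.eq_one_iff, Subgroup.mem_subgroupOf] at hfx
    obtain ⟨a, ha⟩ := (mem_contCoboundaries_iff _).mp hfx
    change (QuotientGroup.mk f :
        contCocycles φ A H₂ ⧸ (contCoboundaries φ A H₂).subgroupOf (contCocycles φ A H₂)) = 1
    rw [QuotientGroup.eq_one_iff, Subgroup.mem_subgroupOf]
    refine (mem_contCoboundaries_iff _).mpr ⟨a, ?_⟩
    funext x
    have := congrFun ha ⟨x.1, h' x.2⟩
    simpa [ContH1.resCocycle] using this

variable {G₀ : Type*} [Group G₀] [TopologicalSpace G₀] {ψ : G₀ →* G'} {hψ : Continuous ψ}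

/-- **Inflation is injective in degree one**: if `ψ : G₀ → G'` maps `H₀` ONTO the subgroup `H'`, then
`infl : H¹(H', A) → H¹(H₀, A)` is injective (a cocycle of `H'` that becomes a coboundary on `H₀` is the
coboundary of the same element on `H'`). [cite: NeukirchSchmidtWingberg2008, I §6] -/
theorem infl_injective_of_surjective {H₀ : Subgroup G₀} {H' : Subgroup G'} (h : H₀.map ψ ≤ H')
    (hsurj : ∀ y : H', ∃ x : H₀, ψ x = y) :
    Function.Injective (ContH1.infl A ψ hψ h) := by
  rw [injective_iff_map_eq_one]
  intro x hx
  induction x using QuotientGroup.induction_on with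
  | H f =>
    have hfx : (QuotientGroup.mk (ContH1.inflCocycle A ψ hψ h f) :
        contCocycles ψ A H₀ ⧸ (contCoboundaries ψ A H₀).subgroupOf (contCocycles ψ A H₀)) = 1 := hx
    rw [QuotientGroup.eq_one_iff, Subgroup.mem_subgroupOf] at hfx
    obtain ⟨a, ha⟩ := (mem_contCoboundaries_iff _).mp hfx
    change (QuotientGroup.mk f :
        contCocycles (MonoidHom.id G') A H' ⧸
          (contCoboundaries (MonoidHom.id G') A H').subgroupOf (contCocycles (MonoidHom.id G') A H')) = 1
    rw [QuotientGroup.eq_one_iff, Subgroup.mem_subgroupOf]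
    refine (mem_contCoboundaries_iff _).mpr ⟨a, ?_⟩
    funext y'
    obtain ⟨x, hx'⟩ := hsurj y'
    have := congrFun ha x
    have hy : y' = ⟨ψ x.1, h ⟨x.1, x.2, rfl⟩⟩ := Subtype.ext hx'.symm
    subst hy
    simpa [ContH1.inflCocycle] using this

end ContH1

/-! ### `log(Θ̈) ≠ 1` -/

namespace ThetaSetting

variable {p : ℕ} [Fact p.Prime] {D : ThetaSetting p}

/-- If the class `log(Θ̈) = id_{Δ_Θ} ∈ H¹(Δ_Θ, Δ_Θ)` ("the identity cocycle", p. 23) is trivial, then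
`Δ_Θ = 1`: a coboundary `x ↦ (x a x⁻¹) a⁻¹` on the commutative group `Δ_Θ` is identically `1`.
[cite: MochizukiEtTh2009, Prop 1.5 (iii) p.23] -/
theorem deltaTheta_eq_bot_of_logTheta_eq_one (h : D.logTheta = 1) : D.DeltaTheta = ⊥ := by
  have h' : (fun x : D.DeltaTheta => x) ∈
      contCoboundaries (MonoidHom.id D.GtpTheta) D.DeltaTheta D.DeltaTheta := by
    have h1 := h
    unfold logTheta at h1
    rw [ContH1.mk_eq_one_iff] at h1
    exact h1
  obtain ⟨a, ha⟩ := (mem_contCoboundaries_iff _).mp h'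
  rw [eq_bot_iff]
  intro x hx
  have hxa := congrFun ha ⟨x, hx⟩
  have hval := congrArg (fun t : D.DeltaTheta => (t : D.GtpTheta)) hxa
  simp only [MonoidHom.id_apply, Subgroup.coe_mul, Subgroup.coe_inv, MulAut.conjNormal_apply] at hval
  have hcomm : x * (a : D.GtpTheta) = a * x := D.ker_thetaToEll_comm x hx a a.2
  rw [Subgroup.mem_bot]
  have : x = x * (a : D.GtpTheta) * x⁻¹ * (a : D.GtpTheta)⁻¹ := hval
  rw [hcomm] at this
  simpa using this

/-- Under the origin guard `IsEtThOrigin` (`Δ_Θ ≠ 1`, it is `≅ Ẑ(1)`, p. 12) the class `log(Θ̈)` is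
nontrivial — the `log(Θ̈)`-clause of Prop. 1.5 (iii) is not vacuous. [cite: MochizukiEtTh2009, Prop 1.5 (iii) p.23] -/
theorem logTheta_ne_one (hO : D.IsEtThOrigin) : D.logTheta ≠ 1 :=
  fun h => hO.deltaTheta_ne_bot (deltaTheta_eq_bot_of_logTheta_eq_one h)

end ThetaSetting

end Literature.AnabelianGeometry.EtaleTheta

end
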